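import Mathlib
import HarnessLib
import Literature.Analysis.Calculus.SmoothTransitionDerivBound

/-!
# Route `KLProgramme` — crux C4a, S3 brick (B4) «(U1)-ZONE-ASSEMBLY» part 11: THE BUMP FAMILY EXISTS — a concrete `C¹` partition of unity of the loop circle with `J`
# windows of length `4·(2π/J)`, `|χ| ≤ 1`, `|χ′| ≤ 6/(2π/J)`, periodisation with shifts `0, ±2π` summing to one (the row block (e) of `…C4aLoopCircleArcs`)

Cell `gate-hubbard-kl`, seat hubbard-kl-k3c3-p3 (g34; row «implicit-function / monotonicity route for μ(n)»).  Located brick for the (C)-closer lane / the (M4)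
assembly of the umklapp first-order ϑ-layer (stub (C) `stub_twoLeg_curvature` of `KLRegimeEngineV17F2`, stmt-HubbardSuperconductivity-20437), memo
HOME/hubbard-kl-k3c3-p3/U1-CAUSTIC-SUP.md §16.

WHY.  `…C4aLoopCircleArcs.loopCircle_twoArcs_integral_le` asks a bump family `χ_j` (`j < J`): `C¹`, `tsupport χ_j ⊆ (φa_j, φb_j)`, `φb_j − φa_j ≤ L`, windows inside
`(v₀ − 2π, v₀ + 4π)`, `|χ_j| ≤ 1`, `|χ_j′| ≤ B₁`, `∑_{j<J}(χ_j(v) + χ_j(v+2π) + χ_j(v−2π)) = 1` on `[v₀, v₀+2π]`.  Here it is built from Mathlib's `Real.smoothTransition` `S`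
(`C^∞`, `= 0` on `(−∞,0]`, `= 1` on `[1,∞)`, values in `[0,1]`, `|S′| ≤ 3` — `Literature.Analysis.Calculus.abs_deriv_smoothTransition_le_three`): with `δ := 2π/J`,
`χ_j(v) := S((v − v₀ − jδ)/δ) − S((v − v₀ − jδ)/δ − 1)` (a telescoping family: `∑_{j<J} χ_j = S(x) − S(x − J)`, `x = (v − v₀)/δ`, and the three shifts give
`S(x + J) − S(x − 2J) = 1` on the period), windows `(v₀ + (j−1)δ, v₀ + (j+3)δ)` of length `L = 4δ`, `B₁ = 6/δ`.  The consumer takes `J ≥ max(2, 8π/L₀)`.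
* **`exists_loopPartition`** (HEADLINE).
Pure calculus; nothing about the model; nothing asserts (C), K3 or superconductivity.  References: [folklore] (partitions of unity); Disertori–Rivasseau 2000 §II.2
[cite: DisertoriRivasseau2000] (the `|S′| ≤ 3` bound's source in the tree).
-/

noncomputable section

namespace Summit.HubbardSuperconductivity.HubbardSuperconductivity.Theorems.C4a

set_option linter.dupNamespace false -- summit = problem name (single-conjunct summit), D-0017

open Real Set

/-- The affine reparametrisation `v ↦ (v − c)/δ` has derivative `1/δ`. -/
theorem hasDerivAt_sub_div (c δ v : ℝ) : HasDerivAt (fun u : ℝ => (u - c) / δ) (1 / δ) v := by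
  have h := ((hasDerivAt_id v).sub_const c).div_const δ
  simpa using h

/-- Derivative of `v ↦ S((v − c)/δ)`: `S′((v − c)/δ)/δ`. -/
theorem hasDerivAt_smoothTransition_affine (c δ v : ℝ) :
    HasDerivAt (fun u : ℝ => Real.smoothTransition ((u - c) / δ)) (deriv Real.smoothTransition ((v - c) / δ) * (1 / δ)) v := by
  have hS : HasDerivAt Real.smoothTransition (deriv Real.smoothTransition ((v - c) / δ)) ((v - c) / δ) :=
    ((Real.smoothTransition.contDiff (n := 1)).differentiable one_ne_zero).differentiableAt.hasDerivAt
  exact hS.comp v (hasDerivAt_sub_div c δ v)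

/-- **THE LOOP PARTITION OF UNITY EXISTS** (HEADLINE; see the module docstring): for every base point `v₀` and every `J ≥ 2` there are `J` bumps `χ_j` with windows
`(φa_j, φb_j)` of length `4(2π/J)` inside `(v₀ − 2π, v₀ + 4π)`, `C¹`, `tsupport χ_j ⊆ (φa_j, φb_j)`, `|χ_j| ≤ 1`, `|χ_j′| ≤ 6/(2π/J)`, and
`∑_{j<J}(χ_j(v) + χ_j(v + 2π) + χ_j(v − 2π)) = 1` on `[v₀, v₀ + 2π]`. -/
theorem exists_loopPartition (v₀ : ℝ) {J : ℕ} (hJ : 2 ≤ J) :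
    ∃ χ : ℕ → ℝ → ℝ, ∃ φa φb : ℕ → ℝ,
      (∀ j < J, φa j ≤ φb j ∧ φb j - φa j ≤ 4 * (2 * π / J)) ∧
      (∀ j < J, Ioo (φa j) (φb j) ⊆ Ioo (v₀ - 2 * π) (v₀ + 4 * π)) ∧
      (∀ j < J, ContDiff ℝ 1 (χ j)) ∧ (∀ j < J, tsupport (χ j) ⊆ Ioo (φa j) (φb j)) ∧
      (∀ j < J, ∀ v, |χ j v| ≤ 1) ∧ (∀ j < J, ∀ v, |deriv (χ j) v| ≤ 6 / (2 * π / J)) ∧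
      (∀ v ∈ Icc v₀ (v₀ + 2 * π), ∑ j ∈ Finset.range J, (χ j v + χ j (v + 2 * π) + χ j (v - 2 * π)) = 1) := by
  have hπ := Real.pi_pos
  have hJ0 : (0 : ℝ) < J := by exact_mod_cast (by omega : 0 < J)
  have hJ2 : (2 : ℝ) ≤ J := by exact_mod_cast hJ
  set δ : ℝ := 2 * π / J with hδ
  have hδ0 : 0 < δ := by positivity
  have hδπ : δ ≤ π := by rw [hδ, div_le_iff₀ hJ0]; nlinarith
  have hJδ : (J : ℝ) * δ = 2 * π := by rw [hδ]; field_simp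
  refine ⟨fun j v => Real.smoothTransition ((v - v₀ - j * δ) / δ) - Real.smoothTransition ((v - v₀ - j * δ) / δ - 1), fun j => v₀ + j * δ - δ, fun j => v₀ + j * δ + 3 * δ,
    ?_, ?_, ?_, ?_, ?_, ?_, ?_⟩
  · -- windows
    intro j _
    constructor <;> linarith
  · -- windows inside `(v₀ − 2π, v₀ + 4π)`
    intro j hj
    have hj' : (j : ℝ) ≤ J - 1 := by
      have : (j : ℝ) + 1 ≤ J := by exact_mod_cast Nat.succ_le_of_lt hj
      linarith
    have hj0 : (0 : ℝ) ≤ j := Nat.cast_nonneg j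
    refine Ioo_subset_Ioo ?_ ?_
    · nlinarith
    · have : (j : ℝ) * δ + 3 * δ ≤ (J : ℝ) * δ + 2 * δ := by nlinarith
      linarith
  · -- `C¹`
    intro j _
    beta_reduce
    have h1 : ContDiff ℝ 1 fun v : ℝ => (v - v₀ - j * δ) / δ := by fun_prop
    have h2 : ContDiff ℝ 1 fun v : ℝ => (v - v₀ - j * δ) / δ - 1 := by fun_prop
    exact ((Real.smoothTransition.contDiff (n := 1)).comp h1).sub ((Real.smoothTransition.contDiff (n := 1)).comp h2)
  · -- support
    intro j _
    beta_reduce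
    have hzero : ∀ v, v ∉ Icc (v₀ + j * δ) (v₀ + j * δ + 2 * δ) → Real.smoothTransition ((v - v₀ - j * δ) / δ) - Real.smoothTransition ((v - v₀ - j * δ) / δ - 1) = 0 := by
      intro v hv
      rw [mem_Icc, not_and_or, not_le, not_le] at hv
      rcases hv with h | h
      · -- left of the window: both arguments `≤ 0`
        have hx : (v - v₀ - j * δ) / δ ≤ 0 := div_nonpos_of_nonpos_of_nonneg (by linarith) hδ0.le
        rw [Real.smoothTransition.zero_of_nonpos hx, Real.smoothTransition.zero_of_nonpos (by linarith), sub_zero]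
      · -- right of the window: both arguments `≥ 1`
        have hx : 1 ≤ (v - v₀ - j * δ) / δ - 1 := by
          rw [le_sub_iff_add_le, le_div_iff₀ hδ0]; linarith
        rw [Real.smoothTransition.one_of_one_le hx, Real.smoothTransition.one_of_one_le (by linarith), sub_self]
    have hsupp : Function.support (fun v => Real.smoothTransition ((v - v₀ - j * δ) / δ) - Real.smoothTransition ((v - v₀ - j * δ) / δ - 1)) ⊆ Icc (v₀ + j * δ) (v₀ + j * δ + 2 * δ) := by
      intro v hv
      by_contra h
      exact hv (hzero v h)
    have htsupp : tsupport (fun v => Real.smoothTransition ((v - v₀ - j * δ) / δ) - Real.smoothTransition ((v - v₀ - j * δ) / δ - 1)) ⊆ Icc (v₀ + j * δ) (v₀ + j * δ + 2 * δ) :=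
      closure_minimal hsupp isClosed_Icc
    exact htsupp.trans fun v hv => ⟨by linarith [hv.1], by linarith [hv.2]⟩
  · -- `|χ| ≤ 1`
    intro j _ v
    beta_reduce
    have h1 := Real.smoothTransition.nonneg ((v - v₀ - j * δ) / δ)
    have h2 := Real.smoothTransition.le_one ((v - v₀ - j * δ) / δ)
    have h3 := Real.smoothTransition.nonneg ((v - v₀ - j * δ) / δ - 1)
    have h4 := Real.smoothTransition.le_one ((v - v₀ - j * δ) / δ - 1)
    rw [abs_le]; constructor <;> linarith
  · -- `|χ′| ≤ 6/δ`
    intro j _ v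
    have hA := hasDerivAt_smoothTransition_affine (v₀ + j * δ) δ v
    have hB := hasDerivAt_smoothTransition_affine (v₀ + j * δ + δ) δ v
    have eA : ∀ u : ℝ, (u - (v₀ + j * δ)) / δ = (u - v₀ - j * δ) / δ := fun u => by ring_nf
    have eB : ∀ u : ℝ, (u - (v₀ + j * δ + δ)) / δ = (u - v₀ - j * δ) / δ - 1 := fun u => by field_simp; ring
    have hA' : HasDerivAt (fun u : ℝ => Real.smoothTransition ((u - v₀ - j * δ) / δ)) (deriv Real.smoothTransition ((v - v₀ - j * δ) / δ) * (1 / δ)) v := by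
      have := hA; simp only [eA] at this; exact this
    have hB' : HasDerivAt (fun u : ℝ => Real.smoothTransition ((u - v₀ - j * δ) / δ - 1)) (deriv Real.smoothTransition ((v - v₀ - j * δ) / δ - 1) * (1 / δ)) v := by
      have := hB; simp only [eB] at this; exact this
    have hAB : HasDerivAt (fun u : ℝ => Real.smoothTransition ((u - v₀ - j * δ) / δ) - Real.smoothTransition ((u - v₀ - j * δ) / δ - 1))
        (deriv Real.smoothTransition ((v - v₀ - j * δ) / δ) * (1 / δ) - deriv Real.smoothTransition ((v - v₀ - j * δ) / δ - 1) * (1 / δ)) v := hA'.sub hB'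
    beta_reduce
    rw [hAB.deriv]
    have h1 := Literature.Analysis.Calculus.abs_deriv_smoothTransition_le_three ((v - v₀ - j * δ) / δ)
    have h2 := Literature.Analysis.Calculus.abs_deriv_smoothTransition_le_three ((v - v₀ - j * δ) / δ - 1)
    rw [← sub_mul, abs_mul, abs_of_pos (by positivity : (0 : ℝ) < 1 / δ), show (6 : ℝ) / δ = 6 * (1 / δ) by ring]
    refine mul_le_mul_of_nonneg_right ?_ (by positivity)
    exact (abs_sub _ _).trans (by linarith)
  · -- the periodised sum is one on the period
    intro v hv
    beta_reduce
    -- telescoping: `∑_{j<J} (S(x − j) − S(x − j − 1)) = S(x) − S(x − J)` for the three base points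
    have htel : ∀ x : ℝ, ∑ j ∈ Finset.range J, (Real.smoothTransition (x - j) - Real.smoothTransition (x - j - 1)) = Real.smoothTransition x - Real.smoothTransition (x - J) := by
      intro x
      have := Finset.sum_range_sub' (fun j : ℕ => Real.smoothTransition (x - j)) J
      simp only [Nat.cast_zero, sub_zero] at this
      rw [← this]
      refine Finset.sum_congr rfl fun j _ => ?_
      push_cast; ring_nf
    have hx : ∀ j : ℕ, ∀ u : ℝ, (u - v₀ - j * δ) / δ = (u - v₀) / δ - j := fun j u => by field_simp
    have hshiftp : (v + 2 * π - v₀) / δ = (v - v₀) / δ + J := by rw [← hJδ]; field_simp; ring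
    have hshiftm : (v - 2 * π - v₀) / δ = (v - v₀) / δ - J := by rw [← hJδ]; field_simp; ring
    set x := (v - v₀) / δ with hxdef
    have hsum3 : ∑ j ∈ Finset.range J, ((Real.smoothTransition ((v - v₀ - j * δ) / δ) - Real.smoothTransition ((v - v₀ - j * δ) / δ - 1)) +
        (Real.smoothTransition ((v + 2 * π - v₀ - j * δ) / δ) - Real.smoothTransition ((v + 2 * π - v₀ - j * δ) / δ - 1)) +
        (Real.smoothTransition ((v - 2 * π - v₀ - j * δ) / δ) - Real.smoothTransition ((v - 2 * π - v₀ - j * δ) / δ - 1))) =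
        (Real.smoothTransition x - Real.smoothTransition (x - J)) + (Real.smoothTransition (x + J) - Real.smoothTransition (x + J - J)) + (Real.smoothTransition (x - J) - Real.smoothTransition (x - J - J)) := by
      rw [Finset.sum_add_distrib, Finset.sum_add_distrib, ← htel x, ← htel (x + J), ← htel (x - J)]
      refine congr_arg₂ _ (congr_arg₂ _ ?_ ?_) ?_ <;> refine Finset.sum_congr rfl fun j _ => ?_
      · rw [hx]
      · rw [hx, hshiftp]
      · rw [hx, hshiftm]
    rw [hsum3]
    have hx0 : 0 ≤ x := by rw [hxdef]; exact div_nonneg (by linarith [hv.1]) hδ0.le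
    have hxJ : x ≤ J := by
      rw [hxdef, div_le_iff₀ hδ0, hJδ]; linarith [hv.2]
    have hJ1 : (1 : ℝ) ≤ J := by linarith
    rw [Real.smoothTransition.one_of_one_le (by linarith : (1 : ℝ) ≤ x + J), show x + J - J = x by ring,
      Real.smoothTransition.zero_of_nonpos (by linarith : x - J - J ≤ 0)]
    ring

end Summit.HubbardSuperconductivity.HubbardSuperconductivity.Theorems.C4a

end
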